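import Summits.Langlands.Langlands.Theses.QuadraticWindow
import Summits.Langlands.Langlands.Theorems.QuadraticWindowHostInducedRepRankOne
import Literature.NumberTheory.GaloisRepresentations.ArtinCharacterReciprocityArchimedeanProofs
import Literature.NumberTheory.Automorphic.BaseChangeCyclicCuspidalUnramified
import Literature.NumberTheory.Automorphic.WeaklyRegularGaloisRepCont
import Summits.Langlands.Langlands.Theorems.QuadraticWindowHostInducedRepPatch
import Summits.Langlands.Langlands.Theorems.QuadraticWindowHostInducedRepPaneLawCont
import Summits.Langlands.Langlands.Theorems.QuadraticWindowHostInducedRepGaloisOverKCont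
import Summits.Langlands.Langlands.Theorems.QuadraticWindowHostInducedRepTotallyRealInduction
import Summits.Langlands.Langlands.Theorems.QuadraticWindowHostInducedRepPackageComposeCont
import Summits.Langlands.Langlands.Theorems.QuadraticWindowHostInducedRepPackageComposeInf1
import Summits.Langlands.Langlands.Theorems.QuadraticWindowHostInducedRepInfinityTypeGLOne
import Summits.Langlands.Langlands.Theorems.QuadraticWindowHostInducedRepAsaiTransferCont
import Literature.NumberTheory.Automorphic.AsaiSignContinuation
import Literature.NumberTheory.Automorphic.AsaiSignCont
import Literature.NumberTheory.Automorphic.ReciprocityGLnPatchingFamily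
import Literature.NumberTheory.Automorphic.AsaiSign
import Literature.NumberTheory.Automorphic.WeaklyRegularGaloisRep
import Literature.NumberTheory.Automorphic.ReciprocityGLn
import Literature.NumberTheory.Automorphic.BaseChangeInductionAlong

/-!
# Line `one-transparent-pane` — skeleton v6 (third lead, continuation c1, 2026-08-16) for the crux
`Summit.Langlands.Langlands.Theses.QuadraticWindow.HostInducedRep` (stmt-Langlands-10902)

v6 over v5: the fact-stub `stub_factInf` (infinity types for EVERY `GL_N` over EVERY number field;
XL for `N ≥ 3` at a complex place — Zhelobenko/Kostant) is GONE.  Audit of the consumers: the line used it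
only (i) over the totally real `F₀` — fact-free (`exists_hasArchParameter_gl` +
`exists_hasInfinityType_of_isTotallyReal`) — and (ii) in RANK ONE over the CM field `K`, now the theorem
`exists_hasInfinityType_gl_one` (…InfinityTypeGLOne.lean, p121548, wave-1 worker).  The laundering runs
through the landed primed chain `stub_memberArch_inf1` (p121379) / `stub_memberPaneArch_inf1` (p121395) /
`pkg_member_of_split_inf1`, `stub_package_inf1` (…PackageComposeInf1.lean, p121691), which also no longer
transits the discharged archimedean reciprocity.  Sorries: exactly the 11 remaining `stub_fact*`.
Closure landed: `Theorems/QuadraticWindowHostInducedRep.lean` — `HostInducedRep_proof` (12 facts, p121471)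
and `HostInducedRep_proof_eleven` (11 facts).

# (v5 header)

v5 (this lead) over v4: (a) the fact-stub `stub_factCFTarch` is GONE — the named fact
`artinReciprocity_character_archimedean` is DISCHARGED in the tree
(`artinReciprocity_character_archimedean_holds`, `ArtinCharacterReciprocityArchimedeanProofs`,
p105971) and is fed unconditionally; (b) `stub_factBC` is now the NAMED fact
`ArthurClozel1989_cuspidalBaseChange_unramified` (filed by this lead,
`Literature/NumberTheory/Automorphic/BaseChangeCyclicCuspidalUnramified.lean`, p120878) instead of an
inline body, and `stub_factFPCont` / `stub_factSignPinCont` are stated through their named facts;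
(c) the composition is SLICED: ranks `n ≤ 1` are theorems of the tree with NO fact
(`Slices.hostInducedRep_of_forall_two_le`, `QuadraticWindowHostInducedRepRankOne.lean`, p120839:
`hostInducedRepAt_zero`, `hostInducedRepAt_one`), the stratum "`F` totally real OR CM" uses only
`stub_factS27` (`inducedPackage_of_S27` below), and only the route's NEW case (`F` of mixed
signature, `n ≥ 2`) consumes the remaining twelve fact-stubs.  Sorries: exactly the 12 `stub_fact*`.

(v4 docstring of the first lead follows.)

# Line `one-transparent-pane` — skeleton v4 (lead, 2026-08-16) for the crux
`Summit.Langlands.Langlands.Theses.QuadraticWindow.HostInducedRep` (stmt-Langlands-10902)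

v1 (planner's `Lines/one-transparent-pane.lean`): 7 sorried stubs + `HostInducedRep_of`.  After the
lead's waves 1–4 every stub of v1 is LANDED under `Theorems/` in a kernel-checked (reshaped / conditional)
form, and what is still `sorry` below is EXACTLY the list of UNPROVED PUBLISHED FACTS the line consumes
(registered on the item as fact-stubs `stub_fact*`).  NO other hypothesis: wave 4 re-based the whole
Asai-sign chain on the continuation-form vocabulary `Literature/NumberTheory/Automorphic/AsaiSignCont.lean`
(`HasAsaiPoleCont` / `HasAsaiSignCont`), which removed the Ramanujan-strength raw-product hypothesis of v3
(`stub_hypRawAsaiHolomorphy`, the typed hazard of `Disproof.lean` §13).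

Landed (all `--supports stmt-Langlands-10902`, namespace `…Theorems.HostInducedRep.OneTransparentPane`):
* `stub_patch` (RESHAPED: concrete `GoodPrime` family, control a.e., one-place coverage) — …Patch.lean, p93262;
* `stub_paneLaw_cont : hexCont → hpinCont → htransferCont → pane law (Cont)` (pure logic) — …PaneLawCont.lean,
  p118864 (raw version …PaneLaw.lean, p93489);
* `stub_galoisOverK_cont : FP 9.10 (Cont) → JS-SMO bridge → <registered signature, Cont sign>` —
  …GaloisOverKCont.lean, p118868 (raw versions …GaloisOverK(.Bridge).lean, p93505/p114047);
* `stub_totallyRealInduction_cond : lang.S27 → <registered signature>` with the fact-free every-rank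
  `hasQuadraticInduction` (…TotallyRealInduction.lean, p93625; helpers …InducedCharpoly{Blocks,}.lean);
* `stub_package_cont` (RESHAPED output matching `stub_patch`, Cont sign) = family assembly
  `stub_package_of_member_cont` (…PackageFamilyCont.lean) ∘ `pkg_member_of_split_cont` over SIX landed
  sub-stubs `stub_memberTower/Satake/Arch/PaneArch/Parity` (…Member*.lean) and `stub_memberSign_cont`
  (…MemberSignCont.lean, p118921) — …PackageComposeCont.lean (raw versions …PackageFamily/Compose.lean);
* `asaiPoleTransfer_cont : MokCont → GrbacShahidi → transfer (Cont)` — …AsaiTransferCont.lean, p118897, on top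
  of the 8-file Asai chain …Asai*.lean (p115698 … p117413);
* the sign pin is the named fact `Mok2014_archimedean_parity_of_asaiSignCont` itself (coset form of Mok's
  Cor. 2.5.5 in the Cont currency; raw version `stub_signPin_cond`, …SignPin.lean, p115422).
-/

open scoped NumberField Polynomial Classical Topology -- `Classical`: the place subtypes indexing `mixedSpace K` are `Fintype` classically (`NormedCommRing (mixedSpace K)`)
open Literature.NumberTheory Literature.NumberTheory.Automorphic Literature.NumberTheory.GaloisRepresentations
open Literature.NumberTheory.GaloisRepresentations.QuadraticFamily
open IsDedekindDomain NumberField Filter Polynomial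
open Summit.Langlands.Langlands.Theorems.HostInducedRep.GrsExplicitDescent
open Summit.Langlands.Langlands.Theorems.HostInducedRep.OneTransparentPane
open Summit.Langlands.Langlands.Theorems.HostInducedRep.Slices

set_option linter.dupNamespace false

namespace Summit.Langlands.Langlands.Cruxes.HostInducedRep.OneTransparentPane

/-! ## Fact-stubs: the unproved published results the line consumes (registered on the item) -/

/-- **lang.S27** (Harris–Lan–Taylor–Thorne Thm. A + Varma): Galois representations for regular algebraic
cuspidal `π` over totally real / CM fields, placewise at unramified `v ∤ ℓ`.  Tree named fact. -/
theorem stub_factS27 : exists_galoisRep_of_regularAlgebraic := by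
  sorry

/-- **Fakhruddin–Pilloni 2021, Thm. 9.10** (Galois representations for weakly regular odd conjugate
self-dual cuspidal `π` over a CM field), with oddness in the continuation-form currency
(`HasAsaiSignCont`).  Named fact `FakhruddinPilloni2021_galoisRep_of_weaklyRegular_oddCont`
(Literature/NumberTheory/Automorphic/WeaklyRegularGaloisRepCont.lean, p118704). -/
theorem stub_factFPCont : FakhruddinPilloni2021_galoisRep_of_weaklyRegular_oddCont := by
  sorry

/-- **Jacquet–Shalika 1981 (II) Thm. 4.4 in pairing form**: a.e. conjugate self-duality ⇒ `IsEssConjSelfDual 1`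
for cuspidal `P` over a CM field.  Tree named fact (p95727). -/
theorem stub_factSMO : JacquetShalika1981_isEssConjSelfDual_of_isConjSelfDualAE := by
  sorry

/-- **Arthur–Clozel Ch. 3 Thm. 6.2 + (6.1)–(6.2) / Henniart 2012**: placewise cuspidal cyclic automorphic
induction.  Tree named fact (p84234; also the route crux `AutomorphicInductionUnramified`, stmt-Langlands-15138). -/
theorem stub_factAI : automorphicInduction_cyclic_cuspidal_unramified := by
  sorry

/-- **Arthur–Clozel Ch. 3 Thm. 4.2 (a) + 5.1**: placewise CUSPIDAL cyclic base change of prime degree, for a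
`π` unramified at some place ramified in `E/F` — v5: the NAMED fact
`ArthurClozel1989_cuspidalBaseChange_unramified` (Literature/NumberTheory/Automorphic/BaseChangeCyclicCuspidalUnramified.lean,
p120878; definitionally the v4 inline body = the `hBC` hypothesis of
`HarrisLanTaylorThorne2016.theoremA_existence_of_baseChange`). -/
theorem stub_factBC : ArthurClozel1989_cuspidalBaseChange_unramified := by
  sorry

/-- **Extension of unitary idele class characters along a quadratic `K/F₀` with unramifiedness on a
prescribed set** (Pontryagin duality, Hewitt–Ross I (24.12) / BLGGT arXiv:1010.2561 Lemma A.2.5). -/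
theorem stub_factExt : ∀ (F₀ K : Type) [Field F₀] [NumberField F₀] [Field K] [NumberField K] [Algebra F₀ K]
    (c : K ≃ₐ[F₀] K), Module.finrank F₀ K = 2 → c ≠ 1 →
    ∀ (χ₀ : HeckeCharacter F₀), χ₀.IsUnitary →
    ∀ (U : Set (HeightOneSpectrum (𝓞 K))),
      (∀ u ∈ U, c • u ∈ U → χ₀.IsUnramifiedAt (u.under (𝓞 F₀))) →
      ∃ χ : HeckeCharacter K, χ.IsUnitary ∧
        (∀ x, χ (AdeleRing.ideleBaseChange F₀ K x) = χ₀ x) ∧ ∀ u ∈ U, χ.IsUnramifiedAt u := by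
  sorry

/-- **Arthur–Clozel 1989, archimedean strong lifting** (infinity types through cyclic base change).  Tree named fact. -/
theorem stub_factArchBC : ArthurClozel1989_strongLifting_archimedean := by
  sorry

/-- **Henniart 2012**: infinity type of an automorphic induction.  Tree named fact. -/
theorem stub_factHen : Henniart2012_infinityType_of_automorphicInduction := by
  sorry

/-- **Mok 2014 (Thm. 2.4.10, Lemma 2.2.1, Remark 2.2.2, Cor. 2.5.5 in coset form)** — the archimedean sign
pin, continuation-form currency.  Named fact `Mok2014_archimedean_parity_of_asaiSignCont` (appended to
Literature/NumberTheory/Automorphic/AsaiSignCont.lean, p118725; raw-currency version p114673). -/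
theorem stub_factSignPinCont : Mok2014_archimedean_parity_of_asaiSignCont := by
  sorry

/-- **Mok's Asai-pole dichotomy in CONTINUATION form** (Mok §2.5, Thm. 2.5.4 (a); Grbac–Shahidi 2015
Thm. 4.3 (2)): the named fact `Mok2014_partialAsaiL_continuation_pole_dichotomy` of
`Literature/NumberTheory/Automorphic/AsaiSignCont.lean` (p116699). -/
theorem stub_factMokCont : Mok2014_partialAsaiL_continuation_pole_dichotomy := by
  sorry

/-- **Grbac–Shahidi 2015 Thm. 4.3 / Flicker 1988 / Shahidi 1981 Thm. 5.1, continuation form at `s = 1`**: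
for a cuspidal datum unitary almost everywhere, every partial Asai Euler product is multipliable on a right
half-plane and `(s - 1)^k L^S(s, Π, As^η)` (`k ≤ 1`) continues holomorphically to a neighbourhood of
`{1 < Re s} ∪ {1}` with non-zero value at `1`: the named fact `GrbacShahidi2015_partialAsaiL_at_one` of
`Literature/NumberTheory/Automorphic/AsaiSignContinuation.lean` (p117412). -/
theorem stub_factGS : GrbacShahidi2015_partialAsaiL_at_one := by
  sorry

/-! ## Derived (no new input): Asai-sign existence in the continuation-form currency -/

/-- **Existence of the Asai SIGN `κ` of a conjugate self-dual cuspidal `P`, continuation form** (the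
hypothesis `hexCont` of the pane law and of the laundering), straight from Mok's dichotomy
(`CuspidalAutomorphicRepData.exists_hasAsaiSignCont`). -/
theorem asaiSignExistsCont : ∀ (F E : Type) [Field F] [NumberField F] [Field E] [NumberField E]
    [Algebra F E] (c : E ≃ₐ[F] E), Module.finrank F E = 2 → c ≠ 1 →
    ∀ (N : ℕ) (hcpt : isCompact_glFiniteIntegralLevel N E) (P : CuspidalAutomorphicRepData N E hcpt),
      0 < N → P.1.IsConjSelfDualAE c → ∃ κ : ℤˣ, P.1.HasAsaiSignCont c κ :=
  fun _ _ _ _ _ _ _ _ h2 hc _ _ P hN hP => P.exists_hasAsaiSignCont stub_factMokCont h2 hc hN hP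

/-! ## The totally-real-or-CM stratum (lang.S27 only) -/

/-- **The totally-real-or-CM stratum of the crux needs only lang.S27** (`stub_factS27`): for `F`
quadratic over `F₀` which is totally real OR CM, every cuspidal regular algebraic `π` on `GL_n(𝔸_F)`
and every rank-one Artin avatar `eψ`, the crux's `R` with the host polynomial at every good place —
`ρ := r_{ℓ,ι}(π)` (lang.S27), `ρ' := ρ ⊗ ẽψ` (`exists_twist_package`, landed), `R :=` the semisimplified
`Ind ρ'` (`exists_semisimple_induce_package`, landed); verbatim the landed
`stub_totallyRealInduction_cond` with `IsTotallyReal F` widened to `IsTotallyReal F ∨ IsCMField F`. -/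
theorem inducedPackage_of_S27
    (F₀ F : Type) [Field F₀] [NumberField F₀] [Field F] [NumberField F] [Algebra F₀ F]
    (n : ℕ) (hcpt : isCompact_glFiniteIntegralLevel n F) (π : CuspidalAutomorphicRepData n F hcpt)
    (ℓ : ℕ) [Fact ℓ.Prime] (ι : PadicAlgCl ℓ ≃+* ℂ) (eψ : FramedGaloisRep F ℂ 1)
    (hF : IsTotallyReal F ∨ IsCMField F) (hdeg : Module.finrank F₀ F = 2) (hreg : π.1.IsRegularAlgebraic) :
    ∃ R : FramedGaloisRep F₀ (PadicAlgCl ℓ) (2 * n), R.toGaloisRep.IsSemisimple ∧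
      ∀ (v : HeightOneSpectrum (𝓞 F₀)) (α : HeightOneSpectrum (𝓞 F) → Multiset ℂ)
          (c : HeightOneSpectrum (𝓞 F) → ℂ), ((ℓ : ℕ) : 𝓞 F₀) ∉ v.asIdeal →
        (∀ w : HeightOneSpectrum (𝓞 F), w.under (𝓞 F₀) = v → w.asIdeal.ramificationIdx (𝓞 F₀) = 1 ∧
            π.1.HasSatakeParamAt w (α w) ∧ eψ.IsUnramifiedAt w ∧
            eψ.HasFrobCharpolyAt w (Polynomial.X - Polynomial.C (c w))) →
        R.IsUnramifiedAt v ∧ R.HasFrobCharpolyAt v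
          (∏ᶠ w ∈ {w : HeightOneSpectrum (𝓞 F) | w.under (𝓞 F₀) = v},
              Polynomial.expand (PadicAlgCl ℓ) (w.asIdeal.inertiaDeg (𝓞 F₀))
                (arithFrobPolyOfSatake ι w.residueCard n ((α w).map (fun a ↦ a * c w)))) := by
  obtain ⟨ρ, -, hρ⟩ := stub_factS27 hcpt hF π hreg ℓ ι
  obtain ⟨ρ', hρ'⟩ := exists_twist_package ι π eψ ρ hρ
  haveI : Algebra.IsQuadraticExtension F₀ F := ⟨hdeg⟩
  obtain ⟨R, hRss, hR⟩ := exists_semisimple_induce_package hdeg ρ'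
  refine ⟨R, hRss, fun v α c hv hguard ↦
    hR v (fun w ↦ arithFrobPolyOfSatake ι w.residueCard n ((α w).map (fun a ↦ a * c w)))
      fun w hw ↦ ?_⟩
  obtain ⟨he, hsat, hψu, hψc⟩ := hguard w hw
  refine ⟨he, hρ' w (α w) (c w) ?_ hsat hψu hψc⟩
  have hmem : ((ℓ : ℕ) : 𝓞 F) ∈ w.asIdeal ↔ ((ℓ : ℕ) : 𝓞 F₀) ∈ (w.under (𝓞 F₀)).asIdeal := by
    rw [HeightOneSpectrum.under_asIdeal, Ideal.under_def, Ideal.mem_comap, map_natCast]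
  rw [hmem, hw]
  exact hv

/-! ## The composition -/

/-- **`HostInducedRep_of` — the crux BY NAME from the landed stubs and the fact-stubs above (v6,
SLICED).**  Ranks `n ≤ 1`: theorems of the tree, NO fact (`hostInducedRep_of_forall_two_le`).
`F` totally real or CM: `inducedPackage_of_S27` (`stub_factS27` only).  Otherwise — the route's new
case, `F` of mixed signature and `n ≥ 2` — everything in the continuation-form Asai currency: the pane
law `stub_paneLaw_cont` fed with the sign existence `asaiSignExistsCont` (Mok's dichotomy), the pin
`stub_factSignPinCont` and the transfer `asaiPoleTransfer_cont stub_factMokCont stub_factGS`; the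
laundering `stub_package_inf1` (facts AI, BC, Ext, ArchBC, Hen + the THEOREM `exists_hasInfinityType_gl_one`
+ existence + pin + pane law; the discharged archimedean reciprocity is internal to it) yields the
`GoodPrime` family of odd weakly regular packages; `stub_galoisOverK_cont` (FP 9.10 + JS SMO) turns
each member into a semisimple `ℓ`-adic representation with the twisted Frobenius polynomials;
`stub_patch` patches and reads off at every good place. -/
theorem HostInducedRep_of : Summit.Langlands.Langlands.Theses.QuadraticWindow.HostInducedRep := by
  refine hostInducedRep_of_forall_two_le fun n _hn ↦ ?_
  intro F₀ F _ _ _ _ _ τ hTR hdeg hτ hcpt π e k hreg hpol hpar hodd ℓ _ ι hℓ hunr eψ hψunr hψpar hψnti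
  by_cases hF : IsTotallyReal F ∨ IsCMField F
  · exact inducedPackage_of_S27 F₀ F n hcpt π ℓ ι eψ hF hdeg hreg
  have hF' : ¬ NumberField.IsTotallyReal F := fun h ↦ hF (Or.inl h)
  have hH : Hyps τ n π e k ℓ eψ :=
    ⟨hTR, hdeg, hτ, hreg, hpol, hpar, hodd, hℓ, hunr, hψunr, hψpar, hψnti⟩
  have hpane := stub_paneLaw_cont asaiSignExistsCont stub_factSignPinCont
    (asaiPoleTransfer_cont stub_factMokCont stub_factGS)
  obtain ⟨m, B, hm, hB, hK, τ', T, ψ₁, hsix, hdict, hcov⟩ :=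
    stub_package_inf1 stub_factAI stub_factBC stub_factExt stub_factArchBC stub_factHen
      exists_hasInfinityType_gl_one asaiSignExistsCont stub_factSignPinCont hpane F₀ F τ n hcpt π e k ℓ ι
      eψ hH hF'
  -- the ℓ-adic representation of each member
  have hr : ∀ D : GoodPrime F₀ m B, ∃ r : FramedGaloisRep (sqrtNegField F₀ D.1) (PadicAlgCl ℓ) (2 * n),
      r.toGaloisRep.IsSemisimple ∧
        ∀ (u : HeightOneSpectrum (𝓞 (sqrtNegField F₀ D.1))) (β : Multiset ℂ),
          ((ℓ : ℕ) : 𝓞 (sqrtNegField F₀ D.1)) ∉ u.asIdeal → (τ' D).1.HasSatakeParamAt u β →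
          (ψ₁ D).IsUnramifiedAt u →
            r.IsUnramifiedAt u ∧ r.HasFrobCharpolyAt u (arithFrobPolyOfSatake ι u.residueCard (2 * n)
              (β.map (fun b ↦ b * ((ψ₁ D).valueAtUniformizer u)⁻¹))) := by
    intro D
    haveI : IsCMField (sqrtNegField F₀ D.1) := GoodPrime.isCMField (Or.inl hTR) D
    obtain ⟨h1, h2, h3, h4, h5, h6⟩ := hsix D
    exact stub_galoisOverK_cont stub_factFPCont stub_factSMO (2 * n) (sqrtNegField F₀ D.1) (hK D) (τ' D) (T D)
      (ψ₁ D) h1 h2 h3 h4 h5 h6 ℓ ι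
  choose r hrss hrloc using hr
  refine stub_patch F₀ F n hcpt π ℓ ι eψ m B hm hB r hrss (fun D ↦ ?_) ?_
  · filter_upwards [hdict D] with u hu v α c huv hv hg
    obtain ⟨hℓu, hψu, β, hβ, heq⟩ := hu v α c huv hv hg
    obtain ⟨hunr', hchar⟩ := hrloc D u β hℓu hβ hψu
    exact ⟨hunr', heq ▸ hchar⟩
  · intro v α c hv hg
    obtain ⟨D, hsplit, u, huv, hℓu, hψu, β, hβ, heq⟩ := hcov v α c hv hg
    obtain ⟨hunr', hchar⟩ := hrloc D u β hℓu hβ hψu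
    exact ⟨D, hsplit, u, huv, hunr', heq ▸ hchar⟩

end Summit.Langlands.Langlands.Cruxes.HostInducedRep.OneTransparentPane
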